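import Literature.Geometry.Lorentzian.IMCFRegularity
import Literature.Geometry.Lorentzian.GaussEquationFrame
import HarnessLib

/-!
# The time derivative of the unit normal along a classical inverse mean curvature flow:
# `D_t ν = −dF_t(grad H⁻¹)`

For a normal variation `∂_t F = f ν` of an immersed hypersurface the unit normal evolves by
`D_t ν = −dF(grad_{g_t} f)` (differentiate `h(ν, dF w) = 0` and `h(ν, ν) = 1` in `t`). For a
classical solution of inverse mean curvature flow (`IsClassicalIMCF`, Huisken–Ilmanen 2001, §0
(∗): `∂_t F = H⁻¹ ν`) this is the first of the evolution equations of §1 leading to (1.3), the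
evolution of `H`, which is the remaining analytic input of the Monotonicity Calculation
(`geroch_monotonicity_smooth_of_evolution`, `GerochMonotonicityGauss.lean`).

* `IsClassicalIMCF.covariantDerivAlong_normal_eq` — **`D_t ν = −dF_{t₀}(W)`** at every
  `t₀ ∈ (a, b)`, `p ∈ S`, with `W = grad_{F_{t₀}^*h}(H_{t₀}⁻¹)(p)` (the `sharp` of the differential
  `mvfderiv` of `y ↦ H(t₀, y)⁻¹`);
* `IsClassicalIMCF.val_normal_covariantDerivAlong_velocity` — `h(ν, D_w(∂_t F)) = w(H⁻¹)` along a
  leaf (Leibniz rule for `∂_t F = H⁻¹ ν` and `h(ν, D_w ν) = 0`);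
* `IsClassicalIMCF.contMDiffAt_lift_normal_time` — the lift `t ↦ (F t p, ν_t p) ∈ TX` is smooth
  (joint smoothness of the normal, `IMCFRegularity.lean`).

Everything is proved; there are no definitions and no named facts.

## References

* G. Huisken, T. Ilmanen, *The inverse mean curvature flow and the Riemannian Penrose
  inequality*, J. Differential Geom. 59 (2001) 353–437: §0 (∗), §1 (1.1)–(1.3).
* G. Huisken, A. Polden, *Geometric evolution equations for hypersurfaces*, LNM 1713 (1999),
  Thm. 3.2 (evolution of the normal and of the second fundamental form under `∂_t F = f ν`).
-/

noncomputable section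

open Bundle Set Manifold TopologicalSpace Filter Function
open scoped ContDiff Topology Manifold

namespace Literature.Geometry.Lorentzian

open PseudoRiemannianMetric

variable {X : Type*} [TopologicalSpace X] [ChartedSpace E3 X] [IsManifold (𝓡 3) ∞ X]
  {h : ContMDiffRiemannianMetric (𝓡 3) ∞ E3 (TangentSpace (𝓡 3) : X → Type _)}
  [(ofRiemannian h).HasLeviCivita]
  {S : Type*} [TopologicalSpace S] [ChartedSpace (EuclideanSpace ℝ (Fin 2)) S]
  [IsManifold (𝓡 2) ∞ S] {hpb : contMDiff_pullbackBilin (𝓡 3) X (𝓡 2) S ∞}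
  {F : ℝ → S → X} {ν : (t : ℝ) → NormalField (𝓡 3) (F t)} {a b : ℝ}

namespace IsClassicalIMCF

/-- The lift `τ ↦ (F τ p, ν_τ p) ∈ TX` of the unit normal at a fixed point is `C^∞` at every
`t₀ ∈ (a, b)` (joint smoothness of the normal, `contMDiffAt_lift_normal_chartFlow`, restricted to
the time line through `(t₀, φ p)`). [cite: HuiskenIlmanenIMCF2001, §0 (∗)] -/
theorem contMDiffAt_lift_normal_time (Hc : IsClassicalIMCF h hpb F ν a b) {t₀ : ℝ}
    (ht₀ : t₀ ∈ Set.Ioo a b) (p : S) :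
    ContMDiffAt 𝓘(ℝ, ℝ) (𝓡 3).tangent ∞
      (fun τ ↦ (TotalSpace.mk' E3 (F τ p) (ν τ p) : TangentBundle (𝓡 3) X)) t₀ := by
  have hq : ((t₀, extChartAt (𝓡 2) p p) : ℝ × EuclideanSpace ℝ (Fin 2)) ∈
      Set.Ioo a b ×ˢ (extChartAt (𝓡 2) p).target := ⟨ht₀, mem_extChartAt_target p⟩
  have h1 := Hc.contMDiffAt_lift_normal_chartFlow (y₀ := p) hq
  have hι : ContMDiff 𝓘(ℝ, ℝ) 𝓘(ℝ, ℝ × EuclideanSpace ℝ (Fin 2)) ∞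
      (fun τ : ℝ ↦ ((τ, extChartAt (𝓡 2) p p) : ℝ × EuclideanSpace ℝ (Fin 2))) :=
    (contDiff_id.prodMk contDiff_const).contMDiff
  have h2 := h1.comp t₀ (hι t₀)
  refine h2.congr_of_eventuallyEq (Eventually.of_forall fun τ ↦ ?_)
  have key : ∀ y : S, p = y → (TotalSpace.mk' E3 (F τ p) (ν τ p) : TangentBundle (𝓡 3) X) =
      TotalSpace.mk' E3 (F τ y) (ν τ y) := by
    rintro y rfl; rfl
  exact key _ (extChartAt_to_inv (I := 𝓡 2) p).symm

/-- **`h(ν, D(∂_t F ∘ c)/dσ) = d/dσ (H⁻¹ ∘ c)` along a curve in a leaf.** For a classical solution,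
`t₀ ∈ (a, b)` and the chart-straight curve `c` through `p` with velocity `v`: the `σ`-covariant
derivative at `0` of the normal velocity field `σ ↦ ∂_t F(t₀, c σ) = H⁻¹ ν` along `σ ↦ F_{t₀}(c σ)`,
paired with `ν`, is the derivative of `σ ↦ H(t₀, c σ)⁻¹` at `0` (Leibniz rule
`covariantDerivAlong_smul_holds` and `h(ν, Dν/dσ) = 0` from `|ν| = 1`). Huisken–Ilmanen 2001, §1
(the normal speed `1/H`). [cite: HuiskenIlmanenIMCF2001, §1 (1.1)] -/
theorem val_normal_covariantDerivAlong_velocity (Hc : IsClassicalIMCF h hpb F ν a b) {t₀ : ℝ}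
    (ht₀ : t₀ ∈ Set.Ioo a b) (p : S) (v : TangentSpace (𝓡 2) p) :
    (ofRiemannian h).val (F t₀ p) (ν t₀ p)
        (covariantDerivAlong (ofRiemannian h).leviCivita (fun t ↦ F t p)
          (fun t ↦ (velocity (𝓡 3) (fun s ↦ F t (curveThrough (𝓡 2) p v s)) 0 : E3)) t₀) =
      deriv (fun s ↦ ((ofRiemannian h).meanCurvature (F t₀) hpb (Hc.isSpacelikeImmersion t₀ ht₀)
        (ν t₀) (curveThrough (𝓡 2) p v s))⁻¹) 0 := by
  set g := ofRiemannian h with hg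
  set cov := g.leviCivita with hcov
  set c : ℝ → S := curveThrough (𝓡 2) p v with hc_def
  set φ : ℝ → ℝ := fun s ↦ (g.meanCurvature (F t₀) hpb (Hc.isSpacelikeImmersion t₀ ht₀) (ν t₀)
    (c s))⁻¹ with hφ_def
  have hLC := isLeviCivita_leviCivita_holds (g := g)
  have hc0 : c 0 = p := curveThrough_zero (𝓡 2) p v
  set f₂ : ℝ → ℝ → X := fun t s ↦ F t (c s) with hf₂
  have hx : ContMDiffAt (𝓘(ℝ, ℝ).prod 𝓘(ℝ, ℝ)) (𝓡 3) 2 (uncurry f₂) (t₀, 0) :=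
    Hc.contMDiffAt_uncurry_curveThrough ht₀ p v
  -- symmetry lemma, with the base curve transported to `t ↦ F t p`
  have hbase : (fun t ↦ f₂ t 0) = fun t ↦ F t p := by
    funext t; simp [hf₂, hc0]
  have hsymm : (covariantDerivAlong cov (fun t ↦ F t p)
      (fun t ↦ (velocity (𝓡 3) (fun s ↦ F t (c s)) 0 : E3)) t₀ : E3) =
        covariantDerivAlong cov (fun s ↦ F t₀ (c s))
          (fun s ↦ velocity (𝓡 3) (fun t ↦ F t (c s)) t₀) 0 := by
    rw [← covariantDerivAlong_congr_base cov hbase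
      (fun t ↦ (velocity (𝓡 3) (fun s ↦ F t (c s)) 0 : E3)) t₀]
    exact covariantDerivAlong_velocity_comm cov hLC.1 hx
  have hW : (fun s ↦ velocity (𝓡 3) (fun t ↦ F t (c s)) t₀) = fun s ↦ φ s • ν t₀ (c s) := by
    funext s; exact Hc.velocity_eq t₀ ht₀ (c s)
  have hνlift := Hc.mdifferentiableAt_lift_normal ht₀ p v
  have hVlift : MDifferentiableAt 𝓘(ℝ, ℝ) (𝓡 3).tangent
      (fun s ↦ (TotalSpace.mk' E3 (F t₀ (c s)) (velocity (𝓡 3) (fun t ↦ F t (c s)) t₀) :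
        TangentBundle (𝓡 3) X)) 0 :=
    mdifferentiableAt_lift_velocity_curry_left hx
  have hφeq : φ = fun s ↦ g.val (F t₀ (c s)) (velocity (𝓡 3) (fun t ↦ F t (c s)) t₀)
      (ν t₀ (c s)) := by
    funext s; exact (Hc.val_velocity_normal ht₀ (c s)).symm
  have hφ : DifferentiableAt ℝ φ 0 := by
    rw [hφeq]; exact (g.hasDerivAt_val_apply_along hLC.2 hVlift hνlift).differentiableAt
  have hLeib := covariantDerivAlong_smul_holds cov (γ := fun s ↦ F t₀ (c s))
    (W := fun s ↦ ν t₀ (c s)) (f := φ) (t₀ := 0) hφ hνlift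
  -- `h(ν, Dν/dσ) = 0` from `h(ν, ν) = 1` along the curve
  have hνν : g.val (F t₀ (c 0)) (ν t₀ (c 0))
      (covariantDerivAlong cov (fun s ↦ F t₀ (c s)) (fun s ↦ ν t₀ (c s)) 0) = 0 := by
    have hd := g.hasDerivAt_val_apply_along hLC.2 (γ := fun s ↦ F t₀ (c s))
      (V := fun s ↦ ν t₀ (c s)) (W := fun s ↦ ν t₀ (c s)) (t₀ := 0) hνlift hνlift
    have hconst : (fun s ↦ g.val (F t₀ (c s)) (ν t₀ (c s)) (ν t₀ (c s))) = fun _ ↦ (1 : ℝ) := by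
      funext s; exact (Hc.isUnitNormal t₀ ht₀).val_self (c s)
    rw [hconst] at hd
    have h0 := hd.unique (hasDerivAt_const 0 (1 : ℝ))
    rw [g.symm (F t₀ (c 0)) (covariantDerivAlong cov (fun s ↦ F t₀ (c s)) (fun s ↦ ν t₀ (c s)) 0)]
      at h0
    linarith
  rw [hsymm, hW, hLeib]
  change g.val (F t₀ p) (ν t₀ p) (deriv φ 0 • (show TangentSpace (𝓡 3) (F t₀ p) from ν t₀ (c 0)) +
    φ 0 • (show TangentSpace (𝓡 3) (F t₀ p) from
      covariantDerivAlong cov (fun s ↦ F t₀ (c s)) (fun s ↦ ν t₀ (c s)) 0)) = _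
  rw [map_add, map_smul, map_smul, smul_eq_mul, smul_eq_mul]
  have key : ∀ z : S, p = z →
      g.val (F t₀ p) (ν t₀ p) (show TangentSpace (𝓡 3) (F t₀ p) from ν t₀ z) = 1 ∧
      g.val (F t₀ p) (ν t₀ p) (show TangentSpace (𝓡 3) (F t₀ p) from
        covariantDerivAlong cov (fun s ↦ F t₀ (c s)) (fun s ↦ ν t₀ (c s)) 0) =
      g.val (F t₀ (c 0)) (ν t₀ (c 0))
        (covariantDerivAlong cov (fun s ↦ F t₀ (c s)) (fun s ↦ ν t₀ (c s)) 0) := by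
    rintro z rfl
    refine ⟨(Hc.isUnitNormal t₀ ht₀).val_self p, ?_⟩
    have : ∀ z' : S, p = z' → g.val (F t₀ p) (ν t₀ p) (show TangentSpace (𝓡 3) (F t₀ p) from
        covariantDerivAlong cov (fun s ↦ F t₀ (c s)) (fun s ↦ ν t₀ (c s)) 0) =
        g.val (F t₀ z') (ν t₀ z')
          (covariantDerivAlong cov (fun s ↦ F t₀ (c s)) (fun s ↦ ν t₀ (c s)) 0) := by
      rintro z' rfl; rfl
    exact this _ hc0.symm
  obtain ⟨k1, k2⟩ := key _ hc0.symm
  rw [k1, k2, hνν, mul_one, mul_zero, add_zero]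

/-- **The time derivative of the unit normal: `D_t ν = −dF_t(grad_{g_t} H⁻¹)`** (Huisken–Ilmanen
2001, §1, the evolution equations of the flow (∗); for a normal variation `∂_t F = f ν` one has
`D_t ν = −dF(grad f)`, here `f = H⁻¹`). For a classical solution, `t₀ ∈ (a, b)` and `p ∈ S`: the
covariant derivative at `t₀`, along `t ↦ F t p`, of `t ↦ ν_t(p)` is `−dF_{t₀}(W)`, `W ∈ T_p S` the
`(F_{t₀}^* h)`-gradient at `p` of `y ↦ H(t₀, y)⁻¹` (`sharp` of its differential). Proof:
differentiating `h(ν_t, dF_t w) = 0` in `t` (compatibility along `t ↦ F t p`,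
`hasDerivAt_val_apply_along`) and using `h(ν, D_t dF w) = w(H⁻¹)`
(`val_normal_covariantDerivAlong_velocity`: `D_t dF w = D_w(∂_tF)`, `∂_t F = H⁻¹ν`) gives
`h(D_t ν, dF w) = −w(H⁻¹) = −(F_{t₀}^*h)(W, w)`; `h(D_t ν, ν) = 0` since `|ν| = 1`; hence `D_t ν + dF W` is orthogonal to `dF(T_pS) ⊕ ℝν = T_{F p}X`
(`val_eq_inducedMetric_add_normal`) and vanishes.
[cite: HuiskenIlmanenIMCF2001, §1 (evolution equations of (∗))] -/
theorem covariantDerivAlong_normal_eq (Hc : IsClassicalIMCF h hpb F ν a b) {t₀ : ℝ}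
    (ht₀ : t₀ ∈ Set.Ioo a b) (p : S) :
    (covariantDerivAlong (ofRiemannian h).leviCivita (fun t ↦ F t p) (fun t ↦ (ν t p : E3)) t₀ :
        E3) =
      -(mfderiv (𝓡 2) (𝓡 3) (F t₀) p
        (((ofRiemannian h).inducedMetric (F t₀) hpb (Hc.isSpacelikeImmersion t₀ ht₀)).sharp p
          (mvfderiv (𝓡 2) (fun y ↦ ((ofRiemannian h).meanCurvature (F t₀) hpb
            (Hc.isSpacelikeImmersion t₀ ht₀) (ν t₀) y)⁻¹) p).toLinearMap) : E3) := by
  set g := ofRiemannian h with hg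
  set cov := g.leviCivita with hcov
  have hLC := isLeviCivita_leviCivita_holds (g := g)
  set D : E3 := covariantDerivAlong cov (fun t ↦ F t p) (fun t ↦ (ν t p : E3)) t₀ with hD
  -- the function `H⁻¹` at time `t₀` and its differential
  have hHm : ContMDiff (𝓡 2) 𝓘(ℝ, ℝ) ∞ (fun y ↦ g.meanCurvature (F t₀) hpb
      (Hc.isSpacelikeImmersion t₀ ht₀) (ν t₀) y) :=
    Hc.contMDiff_meanCurvature ht₀
  have hf : MDifferentiableAt (𝓡 2) 𝓘(ℝ, ℝ) (fun y ↦ (g.meanCurvature (F t₀) hpb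
      (Hc.isSpacelikeImmersion t₀ ht₀) (ν t₀) y)⁻¹) p :=
    (hHm.inv₀ fun y ↦ (Hc.meanCurvature_pos t₀ ht₀ y).ne').mdifferentiableAt (by simp)
  -- regularity of the lifts along `t ↦ F t p`
  have hνlift : MDifferentiableAt 𝓘(ℝ, ℝ) (𝓡 3).tangent
      (fun t ↦ (TotalSpace.mk' E3 (F t p) (ν t p) : TangentBundle (𝓡 3) X)) t₀ :=
    (Hc.contMDiffAt_lift_normal_time ht₀ p).mdifferentiableAt (by simp)
  have hWlift : ∀ w : TangentSpace (𝓡 2) p, MDifferentiableAt 𝓘(ℝ, ℝ) (𝓡 3).tangent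
      (fun t ↦ (TotalSpace.mk' E3 (F t p)
        (velocity (𝓡 3) (fun s ↦ F t (curveThrough (𝓡 2) p w s)) 0 : E3) :
          TangentBundle (𝓡 3) X)) t₀ := fun w ↦ by
    set f₂ : ℝ → ℝ → X := fun t s ↦ F t (curveThrough (𝓡 2) p w s) with hf₂
    have hbase : (fun t ↦ f₂ t 0) = fun t ↦ F t p := by
      funext t; simp [hf₂, curveThrough_zero]
    exact mdifferentiableAt_lift_congr_base hbase
      (mdifferentiableAt_lift_velocity_curry_right (Hc.contMDiffAt_uncurry_curveThrough ht₀ p w))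
  -- (A) tangential pairings: `h(D, dF w) = -d(H⁻¹)(w)`
  have hA : ∀ w : TangentSpace (𝓡 2) p, g.val (F t₀ p) D (mfderiv (𝓡 2) (𝓡 3) (F t₀) p w) =
      -(mvfderiv (𝓡 2) (fun y ↦ (g.meanCurvature (F t₀) hpb
        (Hc.isSpacelikeImmersion t₀ ht₀) (ν t₀) y)⁻¹) p w) := by
    intro w
    have hd := g.hasDerivAt_val_apply_along hLC.2 (γ := fun t ↦ F t p) (V := fun t ↦ (ν t p : E3))
      (W := fun t ↦ (velocity (𝓡 3) (fun s ↦ F t (curveThrough (𝓡 2) p w s)) 0 : E3)) (t₀ := t₀)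
      hνlift (hWlift w)
    -- the paired function vanishes near `t₀`
    have hzero : (fun t ↦ g.val (F t p) (ν t p)
        (velocity (𝓡 3) (fun s ↦ F t (curveThrough (𝓡 2) p w s)) 0 : E3)) =ᶠ[𝓝 t₀]
        fun _ ↦ (0 : ℝ) := by
      filter_upwards [isOpen_Ioo.mem_nhds ht₀] with t ht
      rw [Hc.velocity_comp_curveThrough ht p w]
      exact (Hc.isUnitNormal t ht).isNormalTo p w
    have h0 := hd.unique ((hasDerivAt_const t₀ (0 : ℝ)).congr_of_eventuallyEq hzero)
    rw [Hc.velocity_comp_curveThrough ht₀ p w, Hc.val_normal_covariantDerivAlong_velocity ht₀ p w]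
      at h0
    -- `d/dσ (H⁻¹ ∘ c) (0) = d(H⁻¹)(w)`
    have hc : HasDerivAt (fun s ↦ (g.meanCurvature (F t₀) hpb (Hc.isSpacelikeImmersion t₀ ht₀)
        (ν t₀) (curveThrough (𝓡 2) p w s))⁻¹)
        (mvfderiv (𝓡 2) (fun y ↦ (g.meanCurvature (F t₀) hpb
          (Hc.isSpacelikeImmersion t₀ ht₀) (ν t₀) y)⁻¹) p w) 0 := by
      have key : ∀ z (hz : p = z) (u : TangentSpace (𝓡 2) z),
          (show EuclideanSpace ℝ (Fin 2) from u) = w →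
          HasDerivAt (fun s ↦ (g.meanCurvature (F t₀) hpb (Hc.isSpacelikeImmersion t₀ ht₀)
            (ν t₀) (curveThrough (𝓡 2) p w s))⁻¹)
            (mfderiv (𝓡 2) 𝓘(ℝ, ℝ) (fun y ↦ (g.meanCurvature (F t₀) hpb
              (Hc.isSpacelikeImmersion t₀ ht₀) (ν t₀) y)⁻¹) z u) 0 →
          HasDerivAt (fun s ↦ (g.meanCurvature (F t₀) hpb (Hc.isSpacelikeImmersion t₀ ht₀)
            (ν t₀) (curveThrough (𝓡 2) p w s))⁻¹)
            (mvfderiv (𝓡 2) (fun y ↦ (g.meanCurvature (F t₀) hpb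
              (Hc.isSpacelikeImmersion t₀ ht₀) (ν t₀) y)⁻¹) p w) 0 := by
        rintro z rfl u rfl h1; exact h1
      have hf' : MDifferentiableAt (𝓡 2) 𝓘(ℝ, ℝ) (fun y ↦ (g.meanCurvature (F t₀) hpb
          (Hc.isSpacelikeImmersion t₀ ht₀) (ν t₀) y)⁻¹) (curveThrough (𝓡 2) p w 0) := by
        rw [curveThrough_zero]; exact hf
      have h1 := hasDerivAt_comp_curve hf'
        ((contMDiffAt_curveThrough_zero (n := 1) p w).mdifferentiableAt one_ne_zero)
      exact key _ (curveThrough_zero (𝓡 2) p w).symm _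
        (velocity_curveThrough_zero_holds BoundarylessManifold.isInteriorPoint w) h1
    rw [hc.deriv, ← hcov, ← hD] at h0
    linarith
  -- (B) normal pairing: `h(D, ν) = 0`
  have hB : g.val (F t₀ p) D (ν t₀ p) = 0 := by
    have hd := g.hasDerivAt_val_apply_along hLC.2 (γ := fun t ↦ F t p) (V := fun t ↦ (ν t p : E3))
      (W := fun t ↦ (ν t p : E3)) (t₀ := t₀) hνlift hνlift
    have hone : (fun t ↦ g.val (F t p) (ν t p) (ν t p)) =ᶠ[𝓝 t₀] fun _ ↦ (1 : ℝ) := by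
      filter_upwards [isOpen_Ioo.mem_nhds ht₀] with t ht
      exact (Hc.isUnitNormal t ht).val_self p
    have h0 := hd.unique ((hasDerivAt_const t₀ (1 : ℝ)).congr_of_eventuallyEq hone)
    rw [g.symm (F t₀ p) (ν t₀ p), ← hcov, ← hD] at h0
    linarith
  -- (C) `D + dF W` is orthogonal to everything
  set W : TangentSpace (𝓡 2) p := (g.inducedMetric (F t₀) hpb (Hc.isSpacelikeImmersion t₀
      ht₀)).sharp p
    (mvfderiv (𝓡 2) (fun y ↦ (g.meanCurvature (F t₀) hpb (Hc.isSpacelikeImmersion t₀ ht₀)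
      (ν t₀) y)⁻¹) p).toLinearMap with hW
  have hWu : ∀ u : TangentSpace (𝓡 2) p,
      (g.inducedMetric (F t₀) hpb (Hc.isSpacelikeImmersion t₀ ht₀)).val p W u =
      mvfderiv (𝓡 2) (fun y ↦ (g.meanCurvature (F t₀) hpb
        (Hc.isSpacelikeImmersion t₀ ht₀) (ν t₀) y)⁻¹) p u := fun u ↦ by
    rw [hW, val_sharp_apply]; rfl
  have hdim : Module.finrank ℝ E3 = Module.finrank ℝ (EuclideanSpace ℝ (Fin 2)) + 1 := by
    simp [E3]
  have horth : ∀ B : TangentSpace (𝓡 3) (F t₀ p),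
      g.val (F t₀ p) ((show TangentSpace (𝓡 3) (F t₀ p) from D) + mfderiv (𝓡 2) (𝓡 3) (F t₀) p W)
        B = 0 := by
    intro B
    have hB' : ∀ u : TangentSpace (𝓡 2) p, g.val (F t₀ p) B (mfderiv (𝓡 2) (𝓡 3) (F t₀) p u) =
        (g.inducedMetric (F t₀) hpb (Hc.isSpacelikeImmersion t₀ ht₀)).val p
          ((g.inducedMetric (F t₀) hpb (Hc.isSpacelikeImmersion t₀ ht₀)).sharp p
            (((g.val (F t₀ p) B).comp (mfderiv (𝓡 2) (𝓡 3) (F t₀) p)).toLinearMap)) u := fun u ↦ by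
      rw [val_sharp_apply]; rfl
    have key := val_eq_inducedMetric_add_normal g hpb (Hc.isSpacelikeImmersion t₀ ht₀) (y := p)
      (νy := ν t₀ p) (A := (show TangentSpace (𝓡 3) (F t₀ p) from D) + mfderiv (𝓡 2) (𝓡 3) (F t₀) p
          W)
      (B := B) (a := 0) (ε := 1) (fun u ↦ (Hc.isUnitNormal t₀ ht₀).isNormalTo p u)
      ((Hc.isUnitNormal t₀ ht₀).val_self p) one_ne_zero hdim (fun u ↦ by
        rw [map_add, _root_.add_apply, hA u, map_zero, _root_.zero_apply]
        change _ + (g.inducedMetric (F t₀) hpb (Hc.isSpacelikeImmersion t₀ ht₀)).val p W u = 0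
        rw [hWu u]; ring) hB'
    rw [key, map_zero, _root_.zero_apply, map_add, _root_.add_apply, hB,
      g.symm (F t₀ p) (mfderiv (𝓡 2) (𝓡 3) (F t₀) p W), (Hc.isUnitNormal t₀ ht₀).isNormalTo p W]
    simp
  have hzero := g.nondegenerate (F t₀ p) _ horth
  -- conclude
  have : (show TangentSpace (𝓡 3) (F t₀ p) from D) = -mfderiv (𝓡 2) (𝓡 3) (F t₀) p W :=
    eq_neg_of_add_eq_zero_left hzero
  exact this

end IsClassicalIMCF

end Literature.Geometry.Lorentzian

end
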